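import Summits.QuantumFields.BalabanUV.T4Continuum.Support.UrsellMoebiusBridge
import Summits.QuantumFields.BalabanUV.T4Continuum.Support.UrsellTermBudget

/-!
# NE5 ∕ U3, route P2 — R-IDENT part (C): ON THE CARRIERS' DOMAIN GEOMETRY the model of record's ordered output `out` (2.13)
# IS route P2's Kotecký–Preiss cluster sum `Σ_{K ∈ clus X} Φᵀ(K)` — the two NE5 routes share ONE representation (MI-R)

Cell `pub-balaban`, unit `b2b-balaban-t4-ne5-p2` (T⁴ fan-out NE5 ∕ node U3, PROVER seat P2 «polymer-activity Lipschitz ∕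
Kotecký–Preiss route», lineage gen 18; journal CLAIM «R-IDENT», design question l.6827).  Summits-side new work under the LEAN
PLACEMENT RULE (cell bookkeeping over the swarm's typed objects; NOT a Literature module; nothing of the manuscripts under audit is
asserted — [Balaban1988RG2Cluster] (2.11)–(2.13) p. 14 are cited for FORM only).  HONEST FRAMING: rung (B)+1 of the FINITE-VOLUME T⁴
continuum programme — NOT infinite volume, NOT a mass gap, NOT the Clay problem, NOT a proof of NE5 (spine 0∕9).  HONEST DEPENDENCY
(cell line, verbatim): continuum YM on T⁴ ⇐ BetaPertH ∧ nine spine estimates (0/9 proved); BetaPertH ⇐ (D1) ∧ (D4) ∧ CAP+tail;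
G-an2-4 gates asym, D1 and NE2/3/4.

WHAT.  Over a `ClusterRepOfDomains.DomainGeometry G` of the carriers and the swarm's label data `B13StepTermLabels.InnerData D`
(socket `B13StepTermSocket.labelsIndexing G D`, hard core `touchInc G`):
* §1 the model of record's `ρᵀ` IS `UrsellMayerSeries.ursT (touchInc G)` (`rfl`); on a same-scale family route P2's hard core `G.inc`
  (same scale ∧ footprints touch) has the same truncated functional (`truncatedWeight_inc_eq_touchInc`);
* §2 **`sum_polyTuples_eq_sum_clus`** — (2.13)'s covering tuples `polyTuples G k X n` (*"(Z₁,…,Zₙ): ∪Zᵢ = X"*) are the disjoint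
  union over route P2's covering FAMILIES `K ∈ G.clus X` of the tuples of `K` with image exactly `K`;
* §3 **`out_eq_clusterSum`** (R-IDENT ON THE CARRIERS): at a step-`k` domain `X`, with the activity `H Z := Σ_{ℓ ∈ innerLabels D k Z}
  act Z ℓ o h`, under (i) the socket's levelwise summability binder (`B13StepTermSocket.out_eq_levelwise`) and (ii) absolute
  convergence of the ordered Ursell series of `H` on every `K ∈ G.clus X` (part (B)'s hypothesis):
  `B13StepTermFamily.out (labelsIndexing G D) (touchInc G) act k o h X = Σ_{K ∈ G.clus X} Φᵀ(K; H)` (for `touchInc G` and for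
  `G.inc`); hence **`outB_clusterRep_eq_out`** ∕ `EBre_eq_re_out`: route P2's represented output `(G.clusterRep ρA ρB).outB g U X`
  with the activities READ OFF the model of record equals the model of record's output — the holder lineage's `representsB` (tuple
  form, `B13StepOfRecord`) and route P2's `Represents` (Kotecký–Preiss form) are two spellings of ONE identification (option α);
* §4 **BOTH BINDERS FROM THE SWARM'S OWN DATA**: an activity majorant `A Z ℓ ≥ ‖act Z ℓ o h‖` with anchored exponential norm `Φ`,
  locality `reach`∕`ν`, `4νΦ < 1` — verbatim the data of `UrsellTermBudget.termRep_b13_of_actNorm` (row O1-d3) — give (i)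
  (`summable_levelNorm_of_actNorm`) AND (ii) (`UKabs_div_le_of_actNorm`: `UKabs K (n+1)∕(n+1)! ≤ #cubes(X)·Φ·(4νΦ)ⁿ`, anchoring the
  first member at a cube of `X`, `UrsellSeriesBound.sum_abs_rhoT_prod_div_factorial_le`); hence **`out_eq_clusterSum_of_actNorm`**.
No estimate is assumed beyond these displayed binders (the activity majorant — the SHAPE of [Balaban1988RG2Cluster] Lemma 3 (2.38)
p. 20 — stays a hypothesis, c4); `FlowStep.BetaPertH`, (B), (B^μ) do not occur.  0 sorry; axioms: the standard trio.
-/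

noncomputable section

open Finset
open scoped BigOperators

namespace Summit.QuantumFields.BalabanUV.T4Continuum.B13OutKPForm

open Literature.Probability.LatticeModels (hcUrsell hcUrsell_congr truncatedWeight truncatedWeight_image truncatedWeight_congr)
open Literature.MathematicalPhysics.QuantumFieldTheory.Balaban1983to89.T4OutputRate (Carriers)
open Literature.MathematicalPhysics.QuantumFieldTheory.Balaban1983to89.T4ActivityLipschitz (ClusterRep clusterSum)
open Summit.QuantumFields.BalabanUV.T4Continuum.ClusterRepOfDomains (DomainGeometry)
open Summit.QuantumFields.BalabanUV.T4Continuum.UrsellMayerSeries (tgraph ursT UKabs Uexact hasSum_clusterSum_exact)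
open Summit.QuantumFields.BalabanUV.T4Continuum.B13StepTermLabels (InnerLabel InnerData innerLabels polyTuples mem_polyTuples
  termLabels Covers)
open Summit.QuantumFields.BalabanUV.T4Continuum.B13StepTermSocket (touchInc labelsIndexing sum_term_termLabels out_eq_levelwise)
open Summit.QuantumFields.BalabanUV.T4Continuum.B13StepTermFamily (term out)

variable {C : Carriers} [DecidableEq C.Dom] {Cube : Type*} [DecidableEq Cube] {Bnd : Type*} [DecidableEq Bnd]
  (G : DomainGeometry C Cube) (D : InnerData C Bnd)

/-! ## §1 One Ursell coefficient, one truncated functional -/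

/-- [folklore] The hard core `touchInc G` is reflexive (nonempty footprints overlap themselves). -/
theorem touchInc_refl (Z : C.Dom) : touchInc G Z Z :=
  G.touch_of_inter _ _ (by rw [Finset.inter_self]; exact G.cubes_nonempty Z)

/-- [folklore] The hard core `touchInc G` is symmetric. -/
theorem touchInc_symm (Z Z' : C.Dom) (h : touchInc G Z Z') : touchInc G Z' Z := G.touch_symm _ _ h

/-- [folklore] THE MODEL OF RECORD'S `ρᵀ` IS THE GENERIC ONE: `B13StepTermLabels.rhoT G Z = ursT (touchInc G) Z` (same term). -/
theorem rhoT_eq_ursT {n : ℕ} (Z : Fin (n + 1) → C.Dom) : B13StepTermLabels.rhoT G Z = ursT (touchInc G) Z := rfl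

/-- [folklore] On a tuple of domains of ONE scale, route P2's hard core `G.inc` (same scale ∧ touching footprints) and `touchInc G`
induce the same Ursell coefficient. -/
theorem ursT_inc_eq_of_scale {ι : Type*} [Fintype ι] [DecidableEq ι] {k : ℕ} (Z : ι → C.Dom) (hZ : ∀ m, C.scale (Z m) = k) :
    ursT G.inc Z = ursT (touchInc G) Z := by
  unfold ursT
  refine hcUrsell_congr fun u _ w _ => ?_
  show G.inc (Z u) (Z w) ↔ touchInc G (Z u) (Z w)
  exact ⟨fun h => h.2, fun h => ⟨(hZ u).trans (hZ w).symm, h⟩⟩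

/-- [folklore] On a family of domains of ONE scale the truncated functionals of `G.inc` and of `touchInc G` coincide (the truncated
functional only reads the hard core on the family). -/
theorem truncatedWeight_inc_eq_touchInc {k : ℕ} {K : Finset C.Dom} (hK : ∀ Z ∈ K, C.scale Z = k) (w : C.Dom → ℂ) :
    truncatedWeight G.inc w K = truncatedWeight (touchInc G) w K := by
  have h := truncatedWeight_image (inc := touchInc G) (inc' := G.inc) (φ := id) (w := w) (w' := w) (C := K)
    (Set.injOn_id _) (fun a ha b hb => ?_) (fun a _ => rfl)
  · simpa only [Finset.image_id] using h
  · show G.inc a b ↔ touchInc G a b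
    exact ⟨fun h => h.2, fun h => ⟨(hK a ha).trans (hK b hb).symm, h⟩⟩

/-! ## §2 The covering tuples regrouped by their supports -/

/-- [folklore] The image of a covering tuple is a covering family of route P2's `clus X`. -/
theorem image_mem_clus {k : ℕ} {X : C.Dom} (hX : C.scale X = k) {n : ℕ} {Z : Fin (n + 1) → C.Dom}
    (hZ : Z ∈ polyTuples G k X n) : Finset.univ.image Z ∈ G.clus X := by
  obtain ⟨hZi, hcov⟩ := (mem_polyTuples G).1 hZ
  rw [DomainGeometry.mem_clus]
  refine ⟨fun Y hY => ?_, ?_⟩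
  · obtain ⟨m, -, rfl⟩ := Finset.mem_image.1 hY
    rw [hX]; exact (hZi m).1
  · rw [Finset.image_biUnion]; exact hcov

/-- [folklore] The covering tuples with image exactly `K ∈ clus X` are the tuples of `K` with image exactly `K`. -/
theorem filter_polyTuples_image_eq {k : ℕ} {X : C.Dom} (hX : C.scale X = k) (n : ℕ) {K : Finset C.Dom} (hK : K ∈ G.clus X) :
    (polyTuples G k X n).filter (fun Z => Finset.univ.image Z = K) =
      (Fintype.piFinset fun _ : Fin (n + 1) => K).filter fun Z => Finset.univ.image Z = K := by
  obtain ⟨hKsub, hKcov⟩ := (DomainGeometry.mem_clus G).1 hK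
  ext Z
  simp only [Finset.mem_filter, Fintype.mem_piFinset, mem_polyTuples]
  constructor
  · rintro ⟨-, hZK⟩
    exact ⟨fun m => hZK ▸ Finset.mem_image_of_mem Z (Finset.mem_univ m), hZK⟩
  · rintro ⟨hZK, hZ⟩
    refine ⟨⟨fun m => ⟨?_, ?_⟩, ?_⟩, hZ⟩
    · have h := hKsub (hZK m)
      rwa [hX] at h
    · rw [← hKcov]
      exact Finset.subset_biUnion_of_mem G.cubes (hZK m)
    · show (Finset.univ.biUnion fun i => G.cubes (Z i)) = G.cubes X
      rw [← Finset.image_biUnion, hZ, hKcov]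

/-- [folklore] **(2.13)'s INDEX SET REGROUPED BY SUPPORTS**: a sum over the covering tuples `polyTuples G k X n` is the sum over
route P2's covering families `K ∈ G.clus X` of the sums over the tuples of `K` with image exactly `K`. -/
theorem sum_polyTuples_eq_sum_clus {M : Type*} [AddCommMonoid M] {k : ℕ} {X : C.Dom} (hX : C.scale X = k) (n : ℕ)
    (F : (Fin (n + 1) → C.Dom) → M) :
    ∑ Z ∈ polyTuples G k X n, F Z =
      ∑ K ∈ G.clus X, ∑ Z ∈ (Fintype.piFinset fun _ : Fin (n + 1) => K) with Finset.univ.image Z = K, F Z := by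
  rw [← Finset.sum_fiberwise_of_maps_to (s := polyTuples G k X n) (t := G.clus X)
    (g := fun Z : Fin (n + 1) → C.Dom => Finset.univ.image Z) (fun Z hZ => image_mem_clus G hX hZ)]
  exact Finset.sum_congr rfl fun K hK => by rw [filter_polyTuples_image_eq G hX n hK]

/-! ## §3 R-IDENT on the carriers: `out = Σ_{K ∈ clus X} Φᵀ(K)` -/

section Junction

variable {Op Hist : Type*} (act : C.Dom → InnerLabel C.Dom Bnd → Op → Hist → ℂ)

/-- [folklore] THE ACTIVITY of a polymer at the input `(o, h)`: the sum of its resummed terms, `H(Z) = Σ_{ℓ ∈ innerLabels k Z} act Z ℓ o h`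
((2.9)∕(2.1)∕(2.3) summed; the model of record's `act` are NAMED PARAMETERS — nothing about Bałaban's terms is asserted). -/
def activity (k : ℕ) (o : Op) (h : Hist) : C.Dom → ℂ := fun Z => ∑ ℓ ∈ innerLabels D k Z, act Z ℓ o h

/-- [folklore] THE LEVEL-`n` SLICE of the model of record's series IS the level-`n` slice of the exactly-supported ordered series summed
over the covering families: `Σ_{t ∈ termLabels k X n} term = Σ_{K ∈ clus X} Uexact (touchInc G) H K (n+1) ∕ (n+1)!`. -/
theorem sum_term_termLabels_eq_sum_clus {k : ℕ} {X : C.Dom} (hX : C.scale X = k) (n : ℕ) (o : Op) (h : Hist) :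
    ∑ t ∈ termLabels G D k X n, term (labelsIndexing G D) (touchInc G) act k ⟨n, t⟩ o h X =
      ∑ K ∈ G.clus X, Uexact (touchInc G) (activity D act k o h) K (n + 1) / ((n + 1).factorial : ℂ) := by
  rw [sum_term_termLabels G D act hX n o h, sum_polyTuples_eq_sum_clus G hX n]
  refine Finset.sum_congr rfl fun K _ => ?_
  unfold Uexact activity
  rw [Finset.sum_div]
  refine Finset.sum_congr rfl fun Z _ => ?_
  rw [rhoT_eq_ursT]
  ring

/-- [folklore] **R-IDENT ON THE CARRIERS' DOMAIN GEOMETRY.**  At a step-`k` domain `X`, under (i) the socket's levelwise summability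
binder and (ii) absolute convergence of the ordered Ursell series of the activity on every covering family `K ∈ G.clus X`, the model
of record's output (2.13) in ORDERED form equals route P2's Kotecký–Preiss cluster sum over the covering families:
`out (labelsIndexing G D) (touchInc G) act k o h X = Σ_{K ∈ G.clus X} Φᵀ(K; H)`. -/
theorem out_eq_clusterSum {k : ℕ} {X : C.Dom} (hX : C.scale X = k) (o : Op) (h : Hist)
    (hsum : Summable fun n => ∑ t ∈ termLabels G D k X n, ‖term (labelsIndexing G D) (touchInc G) act k ⟨n, t⟩ o h X‖)
    (hK : ∀ K ∈ G.clus X, Summable fun n =>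
      UKabs (touchInc G) (activity D act k o h) K (n + 1) / ((n + 1).factorial : ℝ)) :
    out (labelsIndexing G D) (touchInc G) act k o h X =
      ∑ K ∈ G.clus X, truncatedWeight (touchInc G) (activity D act k o h) K := by
  rw [out_eq_levelwise G D act o h hsum, tsum_congr fun n => sum_term_termLabels_eq_sum_clus G D act hX n o h]
  exact (hasSum_clusterSum_exact (touchInc G) (activity D act k o h) (G.clus X) (touchInc_refl G) (touchInc_symm G) hK).tsum_eq

/-- [folklore] The same with route P2's hard core `G.inc` (same scale ∧ touching), i.e. literally the summands of
`ClusterRepOfDomains.DomainGeometry.outB_eq`: `out … k o h X = Σ_{K ∈ G.clus X} truncatedWeight G.inc H K`. -/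
theorem out_eq_clusterSum_inc {k : ℕ} {X : C.Dom} (hX : C.scale X = k) (o : Op) (h : Hist)
    (hsum : Summable fun n => ∑ t ∈ termLabels G D k X n, ‖term (labelsIndexing G D) (touchInc G) act k ⟨n, t⟩ o h X‖)
    (hK : ∀ K ∈ G.clus X, Summable fun n =>
      UKabs (touchInc G) (activity D act k o h) K (n + 1) / ((n + 1).factorial : ℝ)) :
    out (labelsIndexing G D) (touchInc G) act k o h X =
      ∑ K ∈ G.clus X, truncatedWeight G.inc (activity D act k o h) K := by
  rw [out_eq_clusterSum G D act hX o h hsum hK]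
  refine Finset.sum_congr rfl fun K hK' => ?_
  rw [truncatedWeight_inc_eq_touchInc G (k := C.scale X) fun Z hZ =>
    (G.mem_level Z _).1 (((DomainGeometry.mem_clus G).1 hK').1 hZ)]

/-- [folklore] **ONE MI-R FOR BOTH NE5 ROUTES.**  Route P2's represented run-B output `(G.clusterRep ρA ρB).outB g U X` (leaf L01's
carrier, Kotecký–Preiss form) with the activity family READ OFF the model of record at run B's input point on the step catalogue of `X`
(`ρB g U Z = H Z` for the step-`scale X` domains `Z` — the only activities a covering family of `X` reads) EQUALS the model of record's
ordered output `out … (C.scale X) o h X` (holder lineage's `B13StepOfRecord`, tuple form) — under the two displayed convergence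
binders.  Hence route P2's functional `EBre` IS the real part of the model of record's output there. -/
theorem outB_clusterRep_eq_out (ρA ρB : (ℕ → ℝ) → C.BgB → C.Dom → ℂ) {g : ℕ → ℝ} {U : C.BgB} {X : C.Dom} (o : Op) (h : Hist)
    (hρ : ∀ Z ∈ G.level (C.scale X), ρB g U Z = activity D act (C.scale X) o h Z)
    (hsum : Summable fun n => ∑ t ∈ termLabels G D (C.scale X) X n,
      ‖term (labelsIndexing G D) (touchInc G) act (C.scale X) ⟨n, t⟩ o h X‖)
    (hK : ∀ K ∈ G.clus X, Summable fun n =>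
      UKabs (touchInc G) (activity D act (C.scale X) o h) K (n + 1) / ((n + 1).factorial : ℝ)) :
    (G.clusterRep ρA ρB).outB g U X = out (labelsIndexing G D) (touchInc G) act (C.scale X) o h X := by
  rw [DomainGeometry.outB_eq, out_eq_clusterSum_inc G D act rfl o h hsum hK]
  refine Finset.sum_congr rfl fun K hK' => truncatedWeight_congr fun Z hZ => hρ Z (((DomainGeometry.mem_clus G).1 hK').1 hZ)

/-- [folklore] Run A's twin: `(G.clusterRep ρA ρB).outA g U X = out … (C.scale X) o h X` when `ρA g U` agrees on the step catalogue with
the activity read at run A's (transported) input `(o, h)`. -/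
theorem outA_clusterRep_eq_out (ρA ρB : (ℕ → ℝ) → C.BgB → C.Dom → ℂ) {g : ℕ → ℝ} {U : C.BgB} {X : C.Dom} (o : Op) (h : Hist)
    (hρ : ∀ Z ∈ G.level (C.scale X), ρA g U Z = activity D act (C.scale X) o h Z)
    (hsum : Summable fun n => ∑ t ∈ termLabels G D (C.scale X) X n,
      ‖term (labelsIndexing G D) (touchInc G) act (C.scale X) ⟨n, t⟩ o h X‖)
    (hK : ∀ K ∈ G.clus X, Summable fun n =>
      UKabs (touchInc G) (activity D act (C.scale X) o h) K (n + 1) / ((n + 1).factorial : ℝ)) :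
    (G.clusterRep ρA ρB).outA g U X = out (labelsIndexing G D) (touchInc G) act (C.scale X) o h X := by
  rw [DomainGeometry.outA_eq, out_eq_clusterSum_inc G D act rfl o h hsum hK]
  refine Finset.sum_congr rfl fun K hK' => truncatedWeight_congr fun Z hZ => hρ Z (((DomainGeometry.mem_clus G).1 hK').1 hZ)

/-- [folklore] Route P2's run-B functional `EBre` (L01 BY DEFINITION, `ClusterRepOfDomains.represents_re`) at such a point IS the real
part of the model of record's output — the value the holder lineage's recursion `B13StepOfRecord.outB` assigns there. -/
theorem EBre_eq_re_out (ρA ρB : (ℕ → ℝ) → C.BgB → C.Dom → ℂ) {g : ℕ → ℝ} {U : C.BgB} {X : C.Dom} (o : Op) (h : Hist)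
    (hρ : ∀ Z ∈ G.level (C.scale X), ρB g U Z = activity D act (C.scale X) o h Z)
    (hsum : Summable fun n => ∑ t ∈ termLabels G D (C.scale X) X n,
      ‖term (labelsIndexing G D) (touchInc G) act (C.scale X) ⟨n, t⟩ o h X‖)
    (hK : ∀ K ∈ G.clus X, Summable fun n =>
      UKabs (touchInc G) (activity D act (C.scale X) o h) K (n + 1) / ((n + 1).factorial : ℝ)) :
    G.EBre ρA ρB g U X = (out (labelsIndexing G D) (touchInc G) act (C.scale X) o h X).re := by
  unfold DomainGeometry.EBre
  rw [outB_clusterRep_eq_out G D act ρA ρB o h hρ hsum hK]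

end Junction

/-! ## §4 Both convergence binders from the swarm's anchored activity norm (`4νΦ < 1`) -/

section Plug

open Summit.QuantumFields.BalabanUV.T4Continuum.UrsellTreeSum (ind ind_nonneg ind_of_pos)
open Summit.QuantumFields.BalabanUV.T4Continuum.UrsellSeriesBound (levelMajorant levelMajorant_nonneg summable_levelMajorant
  sum_abs_rhoT_prod_div_factorial_le)
open Summit.QuantumFields.BalabanUV.T4Continuum.UrsellTermBudget (actSum actSum_nonneg level_eq level_le sum_le_sum_of_injOn_real)
open Summit.QuantumFields.BalabanUV.T4Continuum.B13TermRep (actMajorant norm_term_le_actMajorant)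
open Summit.QuantumFields.BalabanUV.T4Continuum.UrsellMayerSeries (UKabs_nonneg)

variable {Op Hist : Type*} (act : C.Dom → InnerLabel C.Dom Bnd → Op → Hist → ℂ) (A : C.Dom → InnerLabel C.Dom Bnd → ℝ)
  (reach : C.Dom → Finset Cube)

/-- [folklore] **BINDER (i) FROM THE ACTIVITY MAJORANT**: the levelwise sums of the terms' norms at a step-`k` domain `X` are dominated
by leaf-08's geometric level majorant `Φ·(4νΦ)ⁿ` (`UrsellTermBudget.level_le`), hence summable for `4νΦ < 1`. -/
theorem summable_levelNorm_of_actNorm {ν Φ : ℝ} (hA : ∀ Z ℓ, 0 ≤ A Z ℓ)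
    (hloc : ∀ Z Z', touchInc G Z' Z → ∃ q ∈ reach Z, q ∈ G.cubes Z') (hν : 0 ≤ ν)
    (hreach : ∀ Z, ((reach Z).card : ℝ) ≤ ν * (G.cubes Z).card) (hΦ0 : 0 ≤ Φ) (hsmall : 4 * ν * Φ < 1) {k : ℕ}
    (hΦ : ∀ q : Cube, ∑ Z ∈ G.level k, ind (q ∈ G.cubes Z) * actSum D A k Z * Real.exp ((G.cubes Z).card) ≤ Φ)
    {o : Op} {h : Hist} (hact : ∀ Z ∈ G.level k, ∀ ℓ ∈ innerLabels D k Z, ‖act Z ℓ o h‖ ≤ A Z ℓ)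
    {X : C.Dom} (hX : C.scale X = k) :
    Summable fun n => ∑ t ∈ termLabels G D k X n, ‖term (labelsIndexing G D) (touchInc G) act k ⟨n, t⟩ o h X‖ := by
  refine Summable.of_nonneg_of_le (fun n => Finset.sum_nonneg fun _ _ => norm_nonneg _) (fun n => ?_)
    (summable_levelMajorant hν hΦ0 hsmall)
  calc ∑ t ∈ termLabels G D k X n, ‖term (labelsIndexing G D) (touchInc G) act k ⟨n, t⟩ o h X‖
      ≤ ∑ t ∈ termLabels G D k X n, actMajorant (labelsIndexing G D) (touchInc G) A k X ⟨n, t⟩ := by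
        refine Finset.sum_le_sum fun t ht => norm_term_le_actMajorant fun _ m => ?_
        have hwf := ((B13StepTermLabels.mem_termLabels G D).1 ht).1 m
        exact hact _ hwf.1 _ ((B13StepTermLabels.mem_innerLabels D).2 hwf.2.2)
    _ = ∑ Z ∈ polyTuples G k X n, |(B13StepTermFamily.rhoT (touchInc G) Z : ℝ)| / ((n + 1).factorial : ℝ) *
          ∏ m, actSum D A k (Z m) := level_eq G D A hX n
    _ ≤ levelMajorant ν Φ n := level_le G D A reach hA hloc hν hreach hΦ0 hΦ hX n

/-- [folklore] The activity of a step-`k` polymer is dominated by the activity majorant `actSum` (triangle inequality). -/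
theorem norm_activity_le_actSum {k : ℕ} {o : Op} {h : Hist}
    (hact : ∀ Z ∈ G.level k, ∀ ℓ ∈ innerLabels D k Z, ‖act Z ℓ o h‖ ≤ A Z ℓ) {Z : C.Dom} (hZ : Z ∈ G.level k) :
    ‖activity D act k o h Z‖ ≤ actSum D A k Z :=
  (norm_sum_le _ _).trans (Finset.sum_le_sum fun ℓ hℓ => hact Z hZ ℓ hℓ)

/-- [folklore] **BINDER (ii) FROM THE ACTIVITY MAJORANT**: for a covering family `K ∈ G.clus X`, level `n+1` of the absolute ordered
Ursell series of the activity on `K` obeys `UKabs K (n+1)∕(n+1)! ≤ #cubes(X)·Φ·(4νΦ)ⁿ` — embed the tuples of `K` into the tuples of the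
step catalogue, anchor the FIRST member at a cube of `X` (its footprint lies inside `X`), and apply leaf-08's anchored tree-graph level
bound `UrsellSeriesBound.sum_abs_rhoT_prod_div_factorial_le` per anchor. -/
theorem UKabs_div_le_of_actNorm {ν Φ : ℝ} (hA : ∀ Z ℓ, 0 ≤ A Z ℓ)
    (hloc : ∀ Z Z', touchInc G Z' Z → ∃ q ∈ reach Z, q ∈ G.cubes Z') (hν : 0 ≤ ν)
    (hreach : ∀ Z, ((reach Z).card : ℝ) ≤ ν * (G.cubes Z).card) (hΦ0 : 0 ≤ Φ) {k : ℕ}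
    (hΦ : ∀ q : Cube, ∑ Z ∈ G.level k, ind (q ∈ G.cubes Z) * actSum D A k Z * Real.exp ((G.cubes Z).card) ≤ Φ)
    {o : Op} {h : Hist} (hact : ∀ Z ∈ G.level k, ∀ ℓ ∈ innerLabels D k Z, ‖act Z ℓ o h‖ ≤ A Z ℓ)
    {X : C.Dom} (hX : C.scale X = k) {K : Finset C.Dom} (hK : K ∈ G.clus X) (n : ℕ) :
    UKabs (touchInc G) (activity D act k o h) K (n + 1) / ((n + 1).factorial : ℝ) ≤
      ((G.cubes X).card : ℝ) * levelMajorant ν Φ n := by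
  classical
  -- the finite catalogue of step-`k` domains; `K` lies in it and covers `X`
  set L : Finset C.Dom := G.level k with hL
  obtain ⟨hKL', hKcov⟩ := (DomainGeometry.mem_clus G).1 hK
  have hKL : K ⊆ L := by rw [hL, ← hX]; exact hKL'
  have hXL : X ∈ L := (G.mem_level X k).2 hX
  -- transported data on the subtype `↥L`
  let cubes' : ↥L → Finset Cube := fun p => G.cubes p.1
  let reach' : ↥L → Finset Cube := fun p => reach p.1
  let inc' : ↥L → ↥L → Prop := fun a b => touchInc G a.1 b.1
  let w' : ↥L → ℝ := fun p => actSum D A k p.1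
  have hsymm' : ∀ a b : ↥L, inc' a b → inc' b a := fun a b h => G.touch_symm _ _ h
  have hloc' : ∀ a b : ↥L, inc' b a → ∃ q ∈ reach' a, q ∈ cubes' b := fun a b h => hloc a.1 b.1 h
  have hreach' : ∀ a : ↥L, ((reach' a).card : ℝ) ≤ ν * (cubes' a).card := fun a => hreach a.1
  have hw' : ∀ a : ↥L, 0 ≤ w' a := fun a => actSum_nonneg D A hA k a.1
  have hΦ' : ∀ q : Cube, ∑ p : ↥L, ind (q ∈ cubes' p) * w' p * Real.exp ((cubes' p).card) ≤ Φ := by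
    intro q
    have := hΦ q
    rwa [← Finset.sum_coe_sort L] at this
  -- the lift of a tuple of members of `K` into the catalogue (frozen at `X` off the catalogue — never used there)
  let lift : (Fin (n + 1) → C.Dom) → (Fin (n + 1) → ↥L) := fun Z m => if h : Z m ∈ L then ⟨Z m, h⟩ else ⟨X, hXL⟩
  have hlift : ∀ Z ∈ Fintype.piFinset (fun _ : Fin (n + 1) => K), ∀ m, (lift Z m).1 = Z m := by
    intro Z hZ m
    have hm : Z m ∈ L := hKL (Fintype.mem_piFinset.1 hZ m)
    simp only [lift, dif_pos hm]
  have hinj : Set.InjOn lift (Fintype.piFinset (fun _ : Fin (n + 1) => K) : Set (Fin (n + 1) → C.Dom)) := by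
    intro Z hZ Z' hZ' hZZ'
    funext m
    rw [← hlift Z hZ m, ← hlift Z' hZ' m, hZZ']
  -- the dominating function on the catalogue tuples: the first member anchored at SOME cube of `X`
  let g : (Fin (n + 1) → ↥L) → ℝ := fun Z' => (∑ q ∈ G.cubes X, ind (q ∈ cubes' (Z' 0))) *
    (|(B13StepTermFamily.rhoT inc' Z' : ℝ)| * (∏ m, w' (Z' m)) / ((n + 1).factorial : ℝ))
  have hg0 : ∀ Z', 0 ≤ g Z' := fun Z' => mul_nonneg (Finset.sum_nonneg fun _ _ => ind_nonneg _)
    (div_nonneg (mul_nonneg (abs_nonneg _) (Finset.prod_nonneg fun _ _ => hw' _)) (Nat.cast_nonneg _))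
  have hfac : (0 : ℝ) < (n + 1).factorial := by exact_mod_cast Nat.factorial_pos _
  -- step 1: domination tuple by tuple
  have hdom : ∀ Z ∈ Fintype.piFinset (fun _ : Fin (n + 1) => K),
      |(ursT (touchInc G) Z : ℝ)| * (∏ m, ‖activity D act k o h (Z m)‖) / ((n + 1).factorial : ℝ) ≤ g (lift Z) := by
    intro Z hZ
    have hZK : ∀ m, Z m ∈ K := fun m => Fintype.mem_piFinset.1 hZ m
    have hρ : B13StepTermFamily.rhoT inc' (lift Z) = ursT (touchInc G) Z := by
      unfold B13StepTermFamily.rhoT ursT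
      refine hcUrsell_congr fun m _ m' _ => ?_
      show touchInc G (lift Z m).1 (lift Z m').1 ↔ touchInc G (Z m) (Z m')
      rw [hlift Z hZ m, hlift Z hZ m']
    have hprod : ∏ m, ‖activity D act k o h (Z m)‖ ≤ ∏ m, w' (lift Z m) := by
      refine Finset.prod_le_prod (fun m _ => norm_nonneg _) fun m _ => ?_
      show ‖activity D act k o h (Z m)‖ ≤ actSum D A k (lift Z m).1
      rw [hlift Z hZ m]
      exact norm_activity_le_actSum G D act A hact (hKL (hZK m))
    -- the first member's footprint lies inside `X`: some cube of `X` anchors it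
    obtain ⟨c, hc⟩ := G.cubes_nonempty (Z 0)
    have hcX : c ∈ G.cubes X := by
      rw [← hKcov]
      exact Finset.mem_biUnion.2 ⟨Z 0, hZK 0, hc⟩
    have hone : (1 : ℝ) ≤ ∑ q ∈ G.cubes X, ind (q ∈ cubes' (lift Z 0)) := by
      have hmem : c ∈ cubes' (lift Z 0) := by
        show c ∈ G.cubes (lift Z 0).1
        rw [hlift Z hZ 0]
        exact hc
      rw [← ind_of_pos hmem]
      exact Finset.single_le_sum (f := fun q => ind (q ∈ cubes' (lift Z 0))) (fun q _ => ind_nonneg _) hcX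
    have hrest : 0 ≤ |(B13StepTermFamily.rhoT inc' (lift Z) : ℝ)| * (∏ m, w' (lift Z m)) / ((n + 1).factorial : ℝ) :=
      div_nonneg (mul_nonneg (abs_nonneg _) (Finset.prod_nonneg fun _ _ => hw' _)) (Nat.cast_nonneg _)
    calc |(ursT (touchInc G) Z : ℝ)| * (∏ m, ‖activity D act k o h (Z m)‖) / ((n + 1).factorial : ℝ)
        ≤ |(B13StepTermFamily.rhoT inc' (lift Z) : ℝ)| * (∏ m, w' (lift Z m)) / ((n + 1).factorial : ℝ) := by
          rw [hρ]
          exact div_le_div_of_nonneg_right (mul_le_mul_of_nonneg_left hprod (abs_nonneg _)) (Nat.cast_nonneg _)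
      _ = 1 * (|(B13StepTermFamily.rhoT inc' (lift Z) : ℝ)| * (∏ m, w' (lift Z m)) / ((n + 1).factorial : ℝ)) :=
          (one_mul _).symm
      _ ≤ g (lift Z) := mul_le_mul_of_nonneg_right hone hrest
  -- step 2: the sum of the dominating function, anchor by anchor, is leaf-08's anchored level sum at position `0`
  have hsumg : ∑ Z' : Fin (n + 1) → ↥L, g Z' ≤ ((G.cubes X).card : ℝ) * levelMajorant ν Φ n := by
    have hswap' : ∑ Z' : Fin (n + 1) → ↥L, g Z' = ∑ Z' : Fin (n + 1) → ↥L, ∑ q ∈ G.cubes X,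
        ind (q ∈ cubes' (Z' 0)) * (|(B13StepTermFamily.rhoT inc' Z' : ℝ)| * (∏ m, w' (Z' m)) / ((n + 1).factorial : ℝ)) :=
      Finset.sum_congr rfl fun Z' _ => by simp only [g, Finset.sum_mul]
    rw [hswap', Finset.sum_comm]
    calc ∑ q ∈ G.cubes X, ∑ Z' : Fin (n + 1) → ↥L,
          ind (q ∈ cubes' (Z' 0)) * (|(B13StepTermFamily.rhoT inc' Z' : ℝ)| * (∏ m, w' (Z' m)) / ((n + 1).factorial : ℝ))
        = ∑ q ∈ G.cubes X, (∑ Z' : Fin (n + 1) → ↥L,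
            ind (q ∈ cubes' (Z' 0)) * |(B13StepTermFamily.rhoT inc' Z' : ℝ)| * ∏ m, w' (Z' m)) / ((n + 1).factorial : ℝ) := by
          refine Finset.sum_congr rfl fun q _ => ?_
          rw [Finset.sum_div]
          refine Finset.sum_congr rfl fun Z' _ => ?_
          ring
      _ ≤ ∑ _q ∈ G.cubes X, levelMajorant ν Φ n :=
          Finset.sum_le_sum fun q _ => sum_abs_rhoT_prod_div_factorial_le cubes' reach' inc' w' hsymm' hloc' hν hreach' hw' hΦ0
            hΦ' 0 q
      _ = ((G.cubes X).card : ℝ) * levelMajorant ν Φ n := by rw [Finset.sum_const, nsmul_eq_mul]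
  -- step 3: assemble
  calc UKabs (touchInc G) (activity D act k o h) K (n + 1) / ((n + 1).factorial : ℝ)
      = ∑ Z ∈ Fintype.piFinset (fun _ : Fin (n + 1) => K),
          |(ursT (touchInc G) Z : ℝ)| * (∏ m, ‖activity D act k o h (Z m)‖) / ((n + 1).factorial : ℝ) := by
        unfold UKabs; rw [Finset.sum_div]
    _ ≤ ∑ Z' ∈ (Finset.univ : Finset (Fin (n + 1) → ↥L)), g Z' :=
        sum_le_sum_of_injOn_real lift hinj (fun _ _ => Finset.mem_univ _) (fun Z' _ => hg0 Z') hdom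
    _ ≤ ((G.cubes X).card : ℝ) * levelMajorant ν Φ n := hsumg

/-- [folklore] Hence binder (ii): for `4νΦ < 1` the absolute ordered Ursell series of the activity converges on every covering family. -/
theorem summable_UKabs_of_actNorm {ν Φ : ℝ} (hA : ∀ Z ℓ, 0 ≤ A Z ℓ)
    (hloc : ∀ Z Z', touchInc G Z' Z → ∃ q ∈ reach Z, q ∈ G.cubes Z') (hν : 0 ≤ ν)
    (hreach : ∀ Z, ((reach Z).card : ℝ) ≤ ν * (G.cubes Z).card) (hΦ0 : 0 ≤ Φ) (hsmall : 4 * ν * Φ < 1) {k : ℕ}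
    (hΦ : ∀ q : Cube, ∑ Z ∈ G.level k, ind (q ∈ G.cubes Z) * actSum D A k Z * Real.exp ((G.cubes Z).card) ≤ Φ)
    {o : Op} {h : Hist} (hact : ∀ Z ∈ G.level k, ∀ ℓ ∈ innerLabels D k Z, ‖act Z ℓ o h‖ ≤ A Z ℓ)
    {X : C.Dom} (hX : C.scale X = k) {K : Finset C.Dom} (hK : K ∈ G.clus X) :
    Summable fun n => UKabs (touchInc G) (activity D act k o h) K (n + 1) / ((n + 1).factorial : ℝ) :=
  Summable.of_nonneg_of_le (fun n => div_nonneg (UKabs_nonneg _ _ K (n + 1)) (Nat.cast_nonneg _))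
    (fun n => UKabs_div_le_of_actNorm G D act A reach hA hloc hν hreach hΦ0 hΦ hact hX hK n)
    ((summable_levelMajorant hν hΦ0 hsmall).mul_left _)

/-- [folklore] **R-IDENT ON THE CARRIERS FROM THE SWARM'S DATA ALONE**: with an activity majorant of anchored exponential norm `Φ`,
`4νΦ < 1` (verbatim the data of row O1-d3's `UrsellTermBudget.termRep_b13_of_actNorm`), at every step-`k` domain `X` the model of
record's ordered output equals route P2's Kotecký–Preiss cluster sum: `out … k o h X = Σ_{K ∈ G.clus X} Φᵀ_{G.inc}(K; H)`. -/
theorem out_eq_clusterSum_of_actNorm {ν Φ : ℝ} (hA : ∀ Z ℓ, 0 ≤ A Z ℓ)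
    (hloc : ∀ Z Z', touchInc G Z' Z → ∃ q ∈ reach Z, q ∈ G.cubes Z') (hν : 0 ≤ ν)
    (hreach : ∀ Z, ((reach Z).card : ℝ) ≤ ν * (G.cubes Z).card) (hΦ0 : 0 ≤ Φ) (hsmall : 4 * ν * Φ < 1) {k : ℕ}
    (hΦ : ∀ q : Cube, ∑ Z ∈ G.level k, ind (q ∈ G.cubes Z) * actSum D A k Z * Real.exp ((G.cubes Z).card) ≤ Φ)
    {o : Op} {h : Hist} (hact : ∀ Z ∈ G.level k, ∀ ℓ ∈ innerLabels D k Z, ‖act Z ℓ o h‖ ≤ A Z ℓ)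
    {X : C.Dom} (hX : C.scale X = k) :
    out (labelsIndexing G D) (touchInc G) act k o h X =
      ∑ K ∈ G.clus X, truncatedWeight G.inc (activity D act k o h) K :=
  out_eq_clusterSum_inc G D act hX o h (summable_levelNorm_of_actNorm G D act A reach hA hloc hν hreach hΦ0 hsmall hΦ hact hX)
    fun _ hK => summable_UKabs_of_actNorm G D act A reach hA hloc hν hreach hΦ0 hsmall hΦ hact hX hK

end Plug

end Summit.QuantumFields.BalabanUV.T4Continuum.B13OutKPForm

end
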